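import Literature.MathematicalPhysics.QuantumFieldTheory.Federbush1986.PhaseCellIVAppAStatements

/-!
# Federbush, *A phase cell approach to Yang–Mills theory. IV* (CMP **114** (1988) 317–343), Appendix A —
# Theorems A.3 and A.4 RE-TYPED WITH THE PRINTED CONTINUITY («a mapping `f^s : B → M`», «`f^{es} : B − x₀ → M`»)

statement-level skeleton of published theorems with citation tags; proofs where landed; nothing here is a claim about the Yang–Mills mass gap

Cell `lit-balaban`, Phase-2 proof seat **p04** (gen 6); SKELETON rows `F4.ThmA.3`, `F4.ThmA.4` (fold owner r19, referee
ref-5).  Source: P. Federbush, Commun. Math. Phys. **114** (1988) 317–343 [bib `Federbush1988PhaseCellIV`], Appendix A,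
Theorem A.3 (A.25)–(A.26) p. 342 [PDF 26] and Theorem A.4 (A.32)–(A.36) pp. 342–343 [PDF 26–27] (renders
`run/shared/lean/pub/lit-balaban/lit-balaban-r19/renders/f4/f4-p026.png`, `…-p027.png`, read by this seat).

WHY.  The decls of record `PhaseCellIVAppA.ThmA3` / `ThmA4` (p242861) hold VACUOUSLY — `PhaseCellIVThmA34Vacuous.thmA3_holds`,
`thmA4_holds` (this seat, p251138): they do not require the smoothed map to be continuous on the CLOSED ball, so the
boundary condition (A.25)/(A.35) does not constrain the interior and the witness «`f` on `∂B`, a constant inside» satisfies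
them with all `c_α = 0`.  Print's objects are *mappings into the manifold `M`* on `B` (resp. `B − x₀`) — continuous: the
construction (A.30) `f^{s'}_ε(x) = ∫ w^{εd(x)}(x − y) f(y) dy`, `f^s = Pr_M ∘ f^{s'}_ε` (A.31), mollifies at the scale
`εd(x) ↘ 0` towards `∂B` («we note `f^s(x)` is not defined for `x ∈ ∂B` by (A.30), but by (A.25)», p. 342), and (A.38)
`f^{es'}(x) = ∫ w^{d′(x)}(x − y) f((y − x₀)/|y − x₀|) dy` keeps «the argument of `f` … on `∂B`» (p. 343); §11 uses `f^s`,
`f^{es}` as continuous gauge interpolations (Geometric Constructions 5, 6, p. 338).  This file RE-TYPES the two theorems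
with that continuity made explicit and with `f` Lipschitz (print's `Λ₁(f) < ∞`, without which (A.26)/(A.36) say nothing):
* `ThmA3Cont n t M` — Theorem A.3: for `f : B → M` Lipschitz there is `f^s`, continuous on `B`, `C^∞` on the open ball,
  `= f` on `∂B`, with values in `M`, and `‖D^m f^s(x)‖ ≤ c_m d(x, ∂B)^{−(m−1)} Λ₁(f)` for every `m ≥ 1` (as in the decl of
  record: every Lipschitz constant `K` of `f` may stand for `Λ₁(f)`; the `c_m` do not depend on `f`);
* `ThmA4Cont n t M` — Theorem A.4: for `f : ∂B → M` Lipschitz there is `f^{es}`, continuous on `B − x₀`, `C^∞` on the open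
  punctured ball, `= f` on `∂B`, values in `M`, `‖D^m f^{es}(x)‖ ≤ c_m d(x, ∂B ∪ x₀)^{−(m−1)} |x − x₀|^{−1} Λ₁(f)`.
As in the decls of record (module docstring of `PhaseCellIVAppAStatements`): the target is a SET `M ⊆ ℝᵗ` (print embeds
the compact manifold `M` in `R^t`, p. 342), its standing hypothesis — compact differentiable submanifold without boundary —
being the hypothesis under which print ASSERTS the statement (the hypothesis of a future `…_holds`), not a field; distances
in `M` are the ambient ones of `R^t`.  `Prop`-valued definitions, NOT asserted and NOT proved here: the printed proof needs
the smooth nearest-point projection `Pr_M` on a tubular neighbourhood of `M` (p. 342, after (A.31)), which Mathlib does not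
have.  PROVED here (kernel): the re-typed statements imply the decls of record restricted to Lipschitz data
(`thmA3_restricted_of_thmA3Cont`, `thmA4_restricted_of_thmA4Cont`) — i.e. they only ADD requirements — and the first-order
case of the bound makes `f^s` Lipschitz-bounded in the interior in the precise sense `‖D f^s(x)‖ ≤ c₁ Λ₁(f)`
(`fderiv_bound_of_thmA3Cont`), the form §11 (11.9) consumes.

v1.1 (append-only §3, same seat): the CAPPED forms `ThmA3ContCap` / `ThmA4ContCap` — p. 339 «Caution. The geometric
theorems of Appendix A, require a universal bound on `Λ₁` of `φ`'s»: constants `c_m = c_m(c₁)` for data with `Λ₁(f) ≤ c₁`,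
which is what the printed proof (one mollification ratio `ε` + projection onto `M`) delivers and what §11 uses; implied by
the uncapped forms (`thmA3ContCap_of_thmA3Cont`, `thmA4ContCap_of_thmA4Cont`).  No v1 declaration changed.
-/

namespace Literature.MathematicalPhysics.QuantumFieldTheory.Federbush1986

noncomputable section

open scoped NNReal ENNReal ContDiff Topology
open Set Metric Filter

namespace PhaseCellIVAppA

/-! ## 1. Theorem A.3 with the printed continuity of `f^s : B → M` -/

/-- **Theorem A.3** p. 342, verbatim: «We consider a mapping `f` of the unit ball `B` into `M`, a compact differentiable
manifold (without boundary) equipped with a metric. *There is a mapping `f^s : B → M`, such that a) `f^s|_{∂B} = f|_{∂B}`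
(A.25), b) `|D^α f^s(x)| ≤ c_α (d(x, ∂B))^{−(|α|−1)} Λ₁(f)` (A.26).*»  RE-TYPING of the decl of record `ThmA3` (p242861)
with the two printed standing features the record omits: `f` is Lipschitz (`Λ₁(f) < ∞`, (11.4)) and `f^s` is a MAPPING
`B → M`, i.e. continuous on the closed ball (it is `C^∞` inside and given by (A.25) on `∂B`: «we note `f^s(x)` is not
defined for `x ∈ ∂B` by (A.30), but by (A.25)»).  Target `M ⊆ R^t` a set, `f^s` an ambient map `ℝⁿ → R^t` with values in
`M` on `B`; (A.26) for every order `m = |α| ≥ 1` as `‖iteratedFDeriv ℝ m f^s x‖ ≤ c_m d(x, ∂B)^{−(m−1)} K` for every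
Lipschitz constant `K` of `f`; the `c_m` independent of `f`.  `Prop`-valued definition, NOT asserted (print proves it under
«`M` a compact differentiable submanifold of `R^t` without boundary» via (A.27)–(A.31) and the normal projection `Pr_M`).
[cite: Federbush1988PhaseCellIV, Theorem A.3 (A.25)–(A.26) p. 342] -/
def ThmA3Cont (n t : ℕ) (M : Set (EuclideanSpace ℝ (Fin t))) : Prop :=
  ∃ c : ℕ → ℝ, ∀ f : ↥(closedBall (0 : EuclideanSpace ℝ (Fin n)) 1) → ↥M, (∃ K : ℝ≥0, LipschitzWith K f) →
    ∃ fs : EuclideanSpace ℝ (Fin n) → EuclideanSpace ℝ (Fin t),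
      MapsTo fs (closedBall 0 1) M ∧
      (∀ x : ↥(sphere (0 : EuclideanSpace ℝ (Fin n)) 1),
        fs x = (f ⟨x.1, sphere_subset_closedBall x.2⟩ : EuclideanSpace ℝ (Fin t))) ∧
      ContinuousOn fs (closedBall 0 1) ∧
      ContDiffOn ℝ ∞ fs (ball 0 1) ∧
      ∀ m : ℕ, 1 ≤ m → ∀ K : ℝ≥0, LipschitzWith K f →
        ∀ x ∈ ball (0 : EuclideanSpace ℝ (Fin n)) 1,
          ‖iteratedFDeriv ℝ m fs x‖ ≤
            c m * ((infDist x (sphere (0 : EuclideanSpace ℝ (Fin n)) 1))⁻¹ ^ (m - 1)) * K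

/-- The re-typed Theorem A.3 only ADDS requirements: it implies the decl of record `ThmA3`'s conclusion for every Lipschitz
`f` (drop the continuity clause).  (The decl of record itself holds outright and vacuously, `thmA3_holds`.)
[cite: Federbush1988PhaseCellIV, Theorem A.3 (A.25)–(A.26) p. 342] -/
theorem thmA3_restricted_of_thmA3Cont {n t : ℕ} {M : Set (EuclideanSpace ℝ (Fin t))} (h : ThmA3Cont n t M) :
    ∃ c : ℕ → ℝ, ∀ f : ↥(closedBall (0 : EuclideanSpace ℝ (Fin n)) 1) → ↥M, (∃ K : ℝ≥0, LipschitzWith K f) →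
    ∃ fs : EuclideanSpace ℝ (Fin n) → EuclideanSpace ℝ (Fin t),
      MapsTo fs (closedBall 0 1) M ∧
      (∀ x : ↥(sphere (0 : EuclideanSpace ℝ (Fin n)) 1),
        fs x = (f ⟨x.1, sphere_subset_closedBall x.2⟩ : EuclideanSpace ℝ (Fin t))) ∧
      ContDiffOn ℝ ∞ fs (ball 0 1) ∧
      ∀ m : ℕ, 1 ≤ m → ∀ K : ℝ≥0, LipschitzWith K f →
        ∀ x ∈ ball (0 : EuclideanSpace ℝ (Fin n)) 1,
          ‖iteratedFDeriv ℝ m fs x‖ ≤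
            c m * ((infDist x (sphere (0 : EuclideanSpace ℝ (Fin n)) 1))⁻¹ ^ (m - 1)) * K := by
  obtain ⟨c, hc⟩ := h
  refine ⟨c, fun f hf => ?_⟩
  obtain ⟨fs, h1, h2, -, h4, h5⟩ := hc f hf
  exact ⟨fs, h1, h2, h4, h5⟩

/-- The first-order case `m = 1` of the re-typed (A.26) is the interior derivative bound `‖D f^s(x)‖ ≤ c₁ Λ₁(f)` on the open
ball (the form in which §11 (11.9) p. 338 consumes Theorem A.3: «`|D^α φ^s(x)| ≤ c ℓ_k^{−|α|}`»).
[cite: Federbush1988PhaseCellIV, Theorem A.3 (A.26) p. 342; (11.9) p. 338] -/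
theorem fderiv_bound_of_thmA3Cont {n t : ℕ} {M : Set (EuclideanSpace ℝ (Fin t))} (h : ThmA3Cont n t M) :
    ∃ c₁ : ℝ, ∀ f : ↥(closedBall (0 : EuclideanSpace ℝ (Fin n)) 1) → ↥M, ∀ K : ℝ≥0, LipschitzWith K f →
    ∃ fs : EuclideanSpace ℝ (Fin n) → EuclideanSpace ℝ (Fin t),
      MapsTo fs (closedBall 0 1) M ∧ ContinuousOn fs (closedBall 0 1) ∧
      (∀ x : ↥(sphere (0 : EuclideanSpace ℝ (Fin n)) 1),
        fs x = (f ⟨x.1, sphere_subset_closedBall x.2⟩ : EuclideanSpace ℝ (Fin t))) ∧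
      DifferentiableOn ℝ fs (ball 0 1) ∧
      ∀ x ∈ ball (0 : EuclideanSpace ℝ (Fin n)) 1, ‖fderiv ℝ fs x‖ ≤ c₁ * K := by
  obtain ⟨c, hc⟩ := h
  refine ⟨c 1, fun f K hK => ?_⟩
  obtain ⟨fs, h1, h2, h3, h4, h5⟩ := hc f ⟨K, hK⟩
  refine ⟨fs, h1, h3, h2, (h4.differentiableOn (by simp)), fun x hx => ?_⟩
  have h := h5 1 le_rfl K hK x hx
  simp only [Nat.sub_self, pow_zero, mul_one] at h
  rwa [← norm_iteratedFDeriv_one (𝕜 := ℝ)] at *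

/-! ## 2. Theorem A.4 with the printed continuity of `f^{es} : B − x₀ → M` -/

/-- **Theorem A.4** p. 343, verbatim (setting of part D p. 342: «We let `f` be a mapping on the boundary of the unit ball
`B`, `B = {|x − x₀| ≤ 1}` (A.32), `f : ∂B → M` (A.33), `M` a compact differentiable manifold (without boundary) equipped
with a metric»): *«There is a mapping `f^{es}` on the ball minus its center `f^{es} : B − x₀ → M` (A.34), such that
a) `f^{es}|_{∂B} = f|_{∂B}` (A.35), b) `|D^α f^{es}| ≤ c_α (d(x, ∂B ∪ x₀))^{−(|α|−1)} · |x − x₀|^{−1} · Λ₁(f)` (A.36).»*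
RE-TYPING of the decl of record `ThmA4` (p242861) with `f` Lipschitz and `f^{es}` CONTINUOUS on `B − x₀` (print's
«mapping … `B − x₀ → M`»; (A.38): the radial mollification, «the argument of `f` remains on `∂B`»).  Conventions as in
`ThmA3Cont`; the `c_m` independent of `f` and `x₀`.  `Prop`-valued definition, NOT asserted.
[cite: Federbush1988PhaseCellIV, Theorem A.4 (A.32)–(A.36) pp. 342–343] -/
def ThmA4Cont (n t : ℕ) (M : Set (EuclideanSpace ℝ (Fin t))) : Prop :=
  ∃ c : ℕ → ℝ, ∀ (x₀ : EuclideanSpace ℝ (Fin n)) (f : ↥(sphere x₀ 1) → ↥M), (∃ K : ℝ≥0, LipschitzWith K f) →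
    ∃ fes : EuclideanSpace ℝ (Fin n) → EuclideanSpace ℝ (Fin t),
      MapsTo fes (closedBall x₀ 1 \ {x₀}) M ∧
      (∀ x : ↥(sphere x₀ 1), fes x = (f x : EuclideanSpace ℝ (Fin t))) ∧
      ContinuousOn fes (closedBall x₀ 1 \ {x₀}) ∧
      ContDiffOn ℝ ∞ fes (ball x₀ 1 \ {x₀}) ∧
      ∀ m : ℕ, 1 ≤ m → ∀ K : ℝ≥0, LipschitzWith K f →
        ∀ x ∈ ball x₀ 1 \ {x₀},
          ‖iteratedFDeriv ℝ m fes x‖ ≤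
            c m * ((infDist x (sphere x₀ 1 ∪ {x₀}))⁻¹ ^ (m - 1)) * ‖x - x₀‖⁻¹ * K

/-- The re-typed Theorem A.4 only ADDS requirements: it implies the decl of record `ThmA4`'s conclusion for every Lipschitz
`f` (drop the continuity clause). [cite: Federbush1988PhaseCellIV, Theorem A.4 (A.34)–(A.36) p. 343] -/
theorem thmA4_restricted_of_thmA4Cont {n t : ℕ} {M : Set (EuclideanSpace ℝ (Fin t))} (h : ThmA4Cont n t M) :
    ∃ c : ℕ → ℝ, ∀ (x₀ : EuclideanSpace ℝ (Fin n)) (f : ↥(sphere x₀ 1) → ↥M), (∃ K : ℝ≥0, LipschitzWith K f) →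
    ∃ fes : EuclideanSpace ℝ (Fin n) → EuclideanSpace ℝ (Fin t),
      MapsTo fes (closedBall x₀ 1 \ {x₀}) M ∧
      (∀ x : ↥(sphere x₀ 1), fes x = (f x : EuclideanSpace ℝ (Fin t))) ∧
      ContDiffOn ℝ ∞ fes (ball x₀ 1 \ {x₀}) ∧
      ∀ m : ℕ, 1 ≤ m → ∀ K : ℝ≥0, LipschitzWith K f →
        ∀ x ∈ ball x₀ 1 \ {x₀},
          ‖iteratedFDeriv ℝ m fes x‖ ≤
            c m * ((infDist x (sphere x₀ 1 ∪ {x₀}))⁻¹ ^ (m - 1)) * ‖x - x₀‖⁻¹ * K := by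
  obtain ⟨c, hc⟩ := h
  refine ⟨c, fun x₀ f hf => ?_⟩
  obtain ⟨fes, h1, h2, -, h4, h5⟩ := hc x₀ f hf
  exact ⟨fes, h1, h2, h4, h5⟩

/-- With continuity on `B − x₀` the vacuity witness of `thmA4_holds` is EXCLUDED as soon as `f` is not constant: a map
continuous on the (connected, for `n ≥ 2`) punctured closed ball that is constant on the open punctured ball and equals `f`
on `∂B` forces `f` to be constant.  We record the elementary special case the argument rests on: if `fes` is continuous on
`B − x₀`, constant `= c` on the open punctured ball, and `= f` on `∂B`, then `f ≡ c` (every boundary point is a limit of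
interior points along its radius).  [cite: Federbush1988PhaseCellIV, Theorem A.4 (A.34)–(A.35) p. 343] -/
theorem boundary_eq_const_of_continuousOn {n t : ℕ} {x₀ : EuclideanSpace ℝ (Fin n)}
    {fes : EuclideanSpace ℝ (Fin n) → EuclideanSpace ℝ (Fin t)} {c : EuclideanSpace ℝ (Fin t)}
    (hcont : ContinuousOn fes (closedBall x₀ 1 \ {x₀}))
    (hconst : ∀ x ∈ ball x₀ 1 \ {x₀}, fes x = c)
    {y : EuclideanSpace ℝ (Fin n)} (hy : y ∈ sphere x₀ 1) : fes y = c := by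
  -- approach `y` radially from inside: `y_s = x₀ + s • (y − x₀)`, `s ↑ 1`
  have hy1 : ‖y - x₀‖ = 1 := by rwa [mem_sphere, dist_eq_norm] at hy
  have hy0 : y - x₀ ≠ 0 := by
    intro h; rw [h, norm_zero] at hy1; exact zero_ne_one hy1
  have hymem : y ∈ closedBall x₀ 1 \ {x₀} := by
    refine ⟨sphere_subset_closedBall hy, ?_⟩
    intro h
    exact hy0 (sub_eq_zero.mpr h)
  -- the radial path and its limit
  let γ : ℝ → EuclideanSpace ℝ (Fin n) := fun s => x₀ + s • (y - x₀)
  have hγ_cont : Continuous γ := by fun_prop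
  have hγ1 : γ 1 = y := by simp [γ]
  have hγ_mem : ∀ s ∈ Ioo (0 : ℝ) 1, γ s ∈ ball x₀ 1 \ {x₀} := by
    intro s hs
    refine ⟨?_, ?_⟩
    · rw [mem_ball, dist_eq_norm]
      simp only [γ, add_sub_cancel_left, norm_smul, hy1, mul_one, Real.norm_eq_abs, abs_of_pos hs.1]
      exact hs.2
    · intro h
      have : s • (y - x₀) = 0 := by simpa [γ] using h
      rcases smul_eq_zero.mp this with h' | h'
      · exact (ne_of_gt hs.1) h'
      · exact hy0 h'
  -- `fes ∘ γ → fes y` as `s → 1⁻` (continuity within the punctured closed ball), and `fes ∘ γ = c` there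
  have hlim : Tendsto (fun s => fes (γ s)) (𝓝[<] (1 : ℝ)) (𝓝 (fes y)) := by
    have h1 : Tendsto γ (𝓝[<] (1 : ℝ)) (𝓝[closedBall x₀ 1 \ {x₀}] y) := by
      refine tendsto_nhdsWithin_iff.mpr ⟨?_, ?_⟩
      · rw [← hγ1]; exact (hγ_cont.tendsto 1).mono_left nhdsWithin_le_nhds
      · have : Ioo (0 : ℝ) 1 ∈ 𝓝[<] (1 : ℝ) := Ioo_mem_nhdsLT zero_lt_one
        filter_upwards [this] with s hs
        exact ⟨ball_subset_closedBall (hγ_mem s hs).1, (hγ_mem s hs).2⟩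
    exact ((hcont y hymem).tendsto).comp h1
  have hconstlim : Tendsto (fun s => fes (γ s)) (𝓝[<] (1 : ℝ)) (𝓝 c) := by
    refine tendsto_const_nhds.congr' ?_
    filter_upwards [Ioo_mem_nhdsLT zero_lt_one] with s hs
    exact (hconst _ (hγ_mem s hs)).symm
  exact tendsto_nhds_unique hlim hconstlim

/-! ## 3. (v1.1) The CAPPED forms — p. 339 «Caution. The geometric theorems of Appendix A, require a universal bound on
`Λ₁` of `φ`'s (as scaled to unit scale)» -/

/-- **Theorem A.3, capped form** (p. 339 «Caution»: the theorems of Appendix A «require a universal bound on `Λ₁`»; cf.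
(A.1) of Theorem A.1, `Λ₁(f) ≤ c₁`).  READING NOTE recorded with this declaration: the printed proof of Theorem A.3 —
mollification at the scale `εd(x)` with ONE `ε` followed by the normal projection onto `M` (A.30)–(A.31) — keeps `f^{s′}_ε`
inside the tubular neighbourhood of `M` only when `Λ₁(f)·ε` is small, so it delivers the LINEAR bound (A.26)
`c_α d(x, ∂B)^{−(|α|−1)} Λ₁(f)` with `c_α` independent of `f` only for `Λ₁(f) ≤ c₁`, `c_α = c_α(c₁)`; this is the form in
which §11 uses it (p. 339).  `ThmA3ContCap` is exactly that: for every cap `c₁` there are constants `c_m` such that every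
`f : B → M` with a Lipschitz constant `K ≤ c₁` has an `f^s` as in `ThmA3Cont`, the bounds being asserted for the capped
constants `K ≤ c₁`.  `ThmA3Cont` (uncapped, `c_m` absolute) implies it (`thmA3ContCap_of_thmA3Cont`); whether the uncapped
form holds for compact submanifolds is not decided here.  `Prop`-valued definition, NOT asserted.
[cite: Federbush1988PhaseCellIV, Theorem A.3 (A.25)–(A.26) p. 342; «Caution» p. 339] -/
def ThmA3ContCap (n t : ℕ) (M : Set (EuclideanSpace ℝ (Fin t))) : Prop :=
  ∀ c₁ : ℝ≥0, ∃ c : ℕ → ℝ, ∀ f : ↥(closedBall (0 : EuclideanSpace ℝ (Fin n)) 1) → ↥M,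
    (∃ K : ℝ≥0, K ≤ c₁ ∧ LipschitzWith K f) →
    ∃ fs : EuclideanSpace ℝ (Fin n) → EuclideanSpace ℝ (Fin t),
      MapsTo fs (closedBall 0 1) M ∧
      (∀ x : ↥(sphere (0 : EuclideanSpace ℝ (Fin n)) 1),
        fs x = (f ⟨x.1, sphere_subset_closedBall x.2⟩ : EuclideanSpace ℝ (Fin t))) ∧
      ContinuousOn fs (closedBall 0 1) ∧
      ContDiffOn ℝ ∞ fs (ball 0 1) ∧
      ∀ m : ℕ, 1 ≤ m → ∀ K : ℝ≥0, K ≤ c₁ → LipschitzWith K f →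
        ∀ x ∈ ball (0 : EuclideanSpace ℝ (Fin n)) 1,
          ‖iteratedFDeriv ℝ m fs x‖ ≤
            c m * ((infDist x (sphere (0 : EuclideanSpace ℝ (Fin n)) 1))⁻¹ ^ (m - 1)) * K

/-- The uncapped re-typing implies the capped one (same `c`, for every cap). [cite: Federbush1988PhaseCellIV, Theorem A.3
p. 342; «Caution» p. 339] -/
theorem thmA3ContCap_of_thmA3Cont {n t : ℕ} {M : Set (EuclideanSpace ℝ (Fin t))} (h : ThmA3Cont n t M) :
    ThmA3ContCap n t M := by
  intro c₁
  obtain ⟨c, hc⟩ := h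
  refine ⟨c, fun f hf => ?_⟩
  obtain ⟨K, -, hK⟩ := hf
  obtain ⟨fs, h1, h2, h3, h4, h5⟩ := hc f ⟨K, hK⟩
  exact ⟨fs, h1, h2, h3, h4, fun m hm K' _ hK' x hx => h5 m hm K' hK' x hx⟩

/-- **Theorem A.4, capped form** (p. 339 «Caution», as for `ThmA3ContCap`): for every cap `c₁` on the Lipschitz constant of
the boundary datum `f : ∂B → M` there are constants `c_m = c_m(c₁)` with (A.34)–(A.36) for a continuous `f^{es}` on
`B − x₀`.  `Prop`-valued definition, NOT asserted. [cite: Federbush1988PhaseCellIV, Theorem A.4 (A.34)–(A.36) p. 343;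
«Caution» p. 339] -/
def ThmA4ContCap (n t : ℕ) (M : Set (EuclideanSpace ℝ (Fin t))) : Prop :=
  ∀ c₁ : ℝ≥0, ∃ c : ℕ → ℝ, ∀ (x₀ : EuclideanSpace ℝ (Fin n)) (f : ↥(sphere x₀ 1) → ↥M),
    (∃ K : ℝ≥0, K ≤ c₁ ∧ LipschitzWith K f) →
    ∃ fes : EuclideanSpace ℝ (Fin n) → EuclideanSpace ℝ (Fin t),
      MapsTo fes (closedBall x₀ 1 \ {x₀}) M ∧
      (∀ x : ↥(sphere x₀ 1), fes x = (f x : EuclideanSpace ℝ (Fin t))) ∧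
      ContinuousOn fes (closedBall x₀ 1 \ {x₀}) ∧
      ContDiffOn ℝ ∞ fes (ball x₀ 1 \ {x₀}) ∧
      ∀ m : ℕ, 1 ≤ m → ∀ K : ℝ≥0, K ≤ c₁ → LipschitzWith K f →
        ∀ x ∈ ball x₀ 1 \ {x₀},
          ‖iteratedFDeriv ℝ m fes x‖ ≤
            c m * ((infDist x (sphere x₀ 1 ∪ {x₀}))⁻¹ ^ (m - 1)) * ‖x - x₀‖⁻¹ * K

/-- The uncapped re-typing implies the capped one. [cite: Federbush1988PhaseCellIV, Theorem A.4 p. 343; «Caution» p. 339] -/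
theorem thmA4ContCap_of_thmA4Cont {n t : ℕ} {M : Set (EuclideanSpace ℝ (Fin t))} (h : ThmA4Cont n t M) :
    ThmA4ContCap n t M := by
  intro c₁
  obtain ⟨c, hc⟩ := h
  refine ⟨c, fun x₀ f hf => ?_⟩
  obtain ⟨K, -, hK⟩ := hf
  obtain ⟨fes, h1, h2, h3, h4, h5⟩ := hc x₀ f ⟨K, hK⟩
  exact ⟨fes, h1, h2, h3, h4, fun m hm K' _ hK' x hx => h5 m hm K' hK' x hx⟩

end PhaseCellIVAppA

end

end Literature.MathematicalPhysics.QuantumFieldTheory.Federbush1986
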